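import Mathlib
import Literature.Analysis.FluidPDE.Tao2016AveragedNS.ShiftSetCascadeFlows
import Literature.Analysis.FluidPDE.Tao2016AveragedNS.ShiftSetCascadeFlux
import Summits.NavierStokesRegularity.NavierStokesRegularity.Theorems.TaoLadderRungTwoFlatCertificateGlueBoundsOn
import HarnessLib

/-!
# Certificate glue on a shift set `𝕊`, III: THE EXACT STEP WITH SLACK from a window certificate's landing
  clause (helper for item stmt-NavierStokesRegularity-22987 `FlatGapCertificatesV2`, crux K_A♭ of route
  TaoLadderRungTwoFlat; cell harvest/h2-tao-ladder, p1 g13)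

(step₀)/`StepSlackOn` of a format-A♭ certificate: every EXACT `𝕊`-flow on a horizon `τ ≥ c₀` from the
weighted `r`-ball around the reference set `Z` steps — at some `τ₁ ≤ c₀`, with amplitude ratio
`a ≥ (1+ε₀)^{-θ₀}` and slack `(1+σ)a ≤ |S_{i₀,1}(τ₁)|` — into the `ρr`-ball around `Z` (shifted by one shell,
rescaled by `a`), with energies under the epoch envelope throughout `[0, τ₁]`. Here `Z` is the FAT
reference set of a window certificate (theory-1 §27): all states whose window part satisfies the
certificate's `Core`, whose wake lies under `Zb`, which vanish beyond the window and are bounded.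

**`exact_flow_step`.** From the all-shell bounds of glue I on `[0, c₀]` (`CertificateGlueOn.exact_flow_bounds`)
and the certificate's LANDING clause (`hland`: crossing time, ratio, slack, a core state `z'` matching the
shifted rescaled window, acceptance of any quiet value in the new top shell, exit bound for the old bottom
shell), the new reference state is `z'` on the window, the landed wake itself behind (distance `0`; it lies
under `Zb` by the exit clause and the STATIC wake-shift inequality
`(1+ε₀)^{θ₀}(Zb_j + r/w_j + D_j) ≤ Zb_{j-1}`), and `0` ahead (the landed quiet tail is within `ρr` by the
STATIC inequality `ν_{k+1}(1+ε₀)^{θ₀} ≤ ρ`).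

HONEST FRAMING: Tao-type MODEL lattice flows on a general nearest-neighbour slot-closed shift set
`𝕊 ∌ (1,1,1)`; the certificate's clauses are HYPOTHESES; nothing here is a statement about the Navier–Stokes
equations.
-/

noncomputable section

-- the sub-problem namespace repeats the summit name by design (D-0017)
set_option linter.dupNamespace false

namespace Summit.NavierStokesRegularity.NavierStokesRegularity.Theorems

open Set Filter Topology MeasureTheory intervalIntegral Literature.Analysis.FluidPDE
  Literature.Analysis.FluidPDE.TaoCascade
open Summit.NavierStokesRegularity.NavierStokesRegularity.Theorems.GappedFrontRobustOn

namespace CertificateGlueOn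

variable {m : ℕ} {𝕊 : Finset (ℤ × ℤ × ℤ)}

/-- If `(1+ε₀)^{-θ₀} ≤ a` (`1+ε₀ > 0`, `a > 0`) then `x / a ≤ (1+ε₀)^{θ₀} x` for `x ≥ 0`. [folklore] -/
theorem div_le_rpow_mul {ε₀ θ₀ a x : ℝ} (hq : 0 < 1 + ε₀) (ha : 0 < a) (h : (1 + ε₀) ^ (-θ₀) ≤ a)
    (hx : 0 ≤ x) : x / a ≤ (1 + ε₀) ^ θ₀ * x := by
  rw [div_le_iff₀ ha]
  have h1 : 1 ≤ (1 + ε₀) ^ θ₀ * a := by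
    calc (1 : ℝ) = (1 + ε₀) ^ θ₀ * (1 + ε₀) ^ (-θ₀) := by
          rw [← Real.rpow_add hq, add_neg_cancel, Real.rpow_zero]
      _ ≤ (1 + ε₀) ^ θ₀ * a := mul_le_mul_of_nonneg_left h (Real.rpow_nonneg hq.le θ₀)
  nlinarith

/-- **THE EXACT STEP WITH SLACK FROM THE LANDING CLAUSE** (see the module docstring). Data and statics as
in glue I at horizon `c` (with `0 < c₀ ≤ c`), plus: `0 < r`, `0 ≤ ρ`, `0 < σ`, the wake-shift inequality, the
quiet-shift inequality, and the certificate's landing clause on `[0, c₀]`. Conclusion for every exact flow on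
`[0, τ]`, `τ ≥ c₀`, from the `r`-ball around a state `z` of the fat reference set: a `StepTo` into the
`ρr`-ball with the epoch envelope `env₀ = ½M²` (window) / `½Zf²` (wake) / `½(ν r/w₋₁)²` (quiet tail), and the
slack `(1+σ)a ≤ |S_{i₀,1}(τ₁)|`.
[cite: Tao2016AveragedNS, §6.3–6.4 Props. 6.4–6.5 (statement shape of the inductive step); §4 Lemma 4.1 (4.5), (4.8)–(4.10)] -/
theorem exact_flow_step (h𝕊 : IsNearestNeighbourSet 𝕊) (h𝕊c : IsSlotClosed 𝕊)
    (h111 : ((1 : ℤ), (1 : ℤ), (1 : ℤ)) ∉ 𝕊) {ε₀ : ℝ} (hε : 0 < ε₀)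
    {α : Fin m → Fin m → Fin m → ℤ × ℤ × ℤ → ℝ} (hαc : IsCancellingCoeffOn 𝕊 α)
    {Cα : ℝ} (hCα0 : 0 ≤ Cα) (hCα : ∀ i, ∑ i₁, ∑ i₂, ∑ μ ∈ 𝕊, |α i₁ i₂ i μ| ≤ Cα)
    {i₀ : Fin m}
    -- window, weights, radius, clocks, exponents, slack
    {Kb Ka : ℤ} (hKb : 0 ≤ Kb) (hKa : 1 ≤ Ka) {Core : (Fin m → ℤ → ℝ) → Prop} {M w : ℤ → ℝ}
    {r ρ θ₀ c₀ c σ : ℝ} (hr : 0 < r) (hρ : 0 ≤ ρ) (hw : ∀ k, 0 < w k) (hc₀ : 0 < c₀) (hc₀c : c₀ ≤ c)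
    (hσ : 0 < σ)
    (hcore : ∀ z z' : Fin m → ℤ → ℝ, (∀ i k, -Kb ≤ k → k ≤ Ka → z i k = z' i k) → Core z → Core z')
    -- wake side
    {Zb Zf : ℤ → ℝ} {Zmin : ℝ} (hZf : ∀ j, j ≤ -Kb → 0 < Zf j) (hZmin : 0 < Zmin)
    (hZmin' : ∀ j, j < -Kb → Zmin ≤ Zf j) (hZbf : ∀ j, j < -Kb → Zb j + r / w j ≤ Zf j / 2)
    (hMZf : M (-Kb) ≤ Zf (-Kb))
    (hcloseB : ∀ j, j < -Kb →
      c * (8 * Cα * (1 + ε₀) ^ ((5 : ℝ) * j / 2) *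
        max (Zf (j - 1)) (max (Zf j) (Zf (j + 1))) * max (Zf (j - 1)) (max (Zf j) (Zf (j + 1))) + 0) ≤
        Zf j / 2)
    (hshiftB : ∀ j, j < -Kb →
      (1 + ε₀) ^ θ₀ * (Zb j + r / w j + c * (8 * Cα * (1 + ε₀) ^ ((5 : ℝ) * j / 2) *
        max (Zf (j - 1)) (max (Zf j) (Zf (j + 1))) * max (Zf (j - 1)) (max (Zf j) (Zf (j + 1))))) ≤
        Zb (j - 1))
    -- quiet side
    {ν : ℤ → ℝ} {ϑ : ℝ}
    (hT1 : ∀ k : ℤ, Ka ≤ k → 2 * (1 + ε₀) ^ (k : ℝ) * w k ≤ w (k + 1))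
    (hcoreTop : ∀ z, Core z → ∀ i, 4 * (w Ka * |z i Ka|) ≤ r)
    (hthin : ∀ K : ℤ, Ka + 1 ≤ K →
      (1 + ε₀) ^ ((5 : ℝ) * K / 2) * r * w (K - 1) ≤ ϑ * w (K - 2) ^ 2)
    (hν : ∀ K : ℤ, Ka ≤ K → 0 ≤ ν K)
    (hcloseA : ∀ K : ℤ, Ka + 1 ≤ K →
      2 * (Real.sqrt 2 * Real.sqrt (4 / 3 * m * (25 / 32 + 0 * (1 + ε₀) ^ ((2 : ℝ) * K))) /
          (2 * (1 + ε₀) ^ ((K - 1 : ℤ) : ℝ)) +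
        coeffAbsOn (botShifts 𝕊) α * c * (ϑ / (1 + ε₀) ^ ((5 : ℝ) / 2)) * ν (K - 1) ^ 2) ≤ ν K)
    (hslowA : ∀ K : ℤ, Ka + 1 ≤ K →
      (1 + ε₀) ^ ((5 : ℝ) * (K - 1 : ℤ) / 2) * coeffAbsOn (botShifts 𝕊) α * c *
        (ν (K - 1) * r / w (K - 2)) ≤ 1 / 2)
    (hMν : M Ka ≤ ν Ka * r / w (Ka - 1))
    (hshiftA : ∀ k : ℤ, Ka < k → ν (k + 1) * (1 + ε₀) ^ θ₀ ≤ ρ)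
    -- the certificate's interior, trapping and landing clauses
    (hinside : ∀ (z S₀ : Fin m → ℤ → ℝ), Core z →
      (∀ i k, -Kb ≤ k → k ≤ Ka → w k * |S₀ i k - z i k| ≤ r) → ∀ i k, -Kb ≤ k → k ≤ Ka → |S₀ i k| < M k)
    (htrap : ∀ (s : ℝ) (z : Fin m → ℤ → ℝ) (S : Fin m → ℤ → ℝ → ℝ), Core z → 0 < s → s ≤ c →
      (∀ i k, -Kb ≤ k → k ≤ Ka → w k * |S i k 0 - z i k| ≤ r) →
      (∀ i k, -Kb ≤ k → k ≤ Ka → ∀ u ∈ Icc 0 s,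
        HasDerivWithinAt (S i k) (quadTermOn 𝕊 ε₀ α S i k u) (Icc 0 s) u) →
      (∀ i, ContinuousOn (S i (-Kb - 1)) (Icc 0 s)) → (∀ i, ContinuousOn (S i (Ka + 1)) (Icc 0 s)) →
      (∀ i, ∀ u ∈ Icc 0 s, |S i (-Kb - 1) u| ≤ Zf (-Kb - 1)) →
      (∀ i, ∀ u ∈ Icc 0 s, |S i (Ka + 1) u| ≤ ν (Ka + 1) * r / w Ka) →
      (∀ i k, -Kb ≤ k → k ≤ Ka → ∀ u ∈ Icc 0 s, |S i k u| ≤ M k) →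
        ∀ i k, -Kb ≤ k → k ≤ Ka → ∀ u ∈ Icc 0 s, |S i k u| < M k)
    (hland : ∀ (z : Fin m → ℤ → ℝ) (S : Fin m → ℤ → ℝ → ℝ), Core z →
      (∀ i k, -Kb ≤ k → k ≤ Ka → w k * |S i k 0 - z i k| ≤ r) →
      (∀ i k, -Kb ≤ k → k ≤ Ka → ∀ u ∈ Icc 0 c₀,
        HasDerivWithinAt (S i k) (quadTermOn 𝕊 ε₀ α S i k u) (Icc 0 c₀) u) →
      (∀ i, ContinuousOn (S i (-Kb - 1)) (Icc 0 c₀)) → (∀ i, ContinuousOn (S i (Ka + 1)) (Icc 0 c₀)) →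
      (∀ i, ∀ u ∈ Icc 0 c₀, |S i (-Kb - 1) u| ≤ Zf (-Kb - 1)) →
      (∀ i, ∀ u ∈ Icc 0 c₀, |S i (Ka + 1) u| ≤ ν (Ka + 1) * r / w Ka) →
      (∀ i k, -Kb ≤ k → k ≤ Ka → ∀ u ∈ Icc 0 c₀, |S i k u| ≤ M k) →
        ∃ (τ₁ a : ℝ) (z' : Fin m → ℤ → ℝ), 0 < τ₁ ∧ τ₁ ≤ c₀ ∧ 0 < a ∧ (1 + ε₀) ^ (-θ₀) ≤ a ∧
          (1 + σ) * a ≤ |S i₀ 1 τ₁| ∧ Core z' ∧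
          (∀ i k, -Kb ≤ k → k + 1 ≤ Ka → w k * |S i (1 + k) τ₁ / a - z' i k| ≤ ρ * r) ∧
          (∀ (i : Fin m) (v : ℝ), |v| ≤ ν (Ka + 1) * r / w Ka → w Ka * |v / a - z' i Ka| ≤ ρ * r) ∧
          (∀ i, |S i (-Kb) τ₁| ≤ a * Zb (-Kb - 1)))
    -- the start state and the flow
    {z : Fin m → ℤ → ℝ} (hzc : Core z) (hzb : ∀ i j, j < -Kb → |z i j| ≤ Zb j)
    (hza : ∀ i k, Ka < k → z i k = 0) {S₀ : Fin m → ℤ → ℝ} (hball : ∀ i k, w k * |S₀ i k - z i k| ≤ r)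
    {τ : ℝ} (hτ : c₀ ≤ τ) {S F : Fin m → ℤ → ℝ → ℝ}
    (hflow : PseudoFlowOnShift 𝕊 τ ε₀ α 0 0 S₀ (fun i k => (1 / 2) * S₀ i k ^ 2) (fun _ _ => 0) S F) :
    ∃ τ₁ a : ℝ, StepTo ε₀ θ₀ c₀ i₀
        (ballDesc {z : Fin m → ℤ → ℝ | Core z ∧ (∀ i j, j < -Kb → |z i j| ≤ Zb j) ∧
          (∀ i k, Ka < k → z i k = 0) ∧ ∃ C : ℝ, ∀ i k, |z i k| ≤ C} w (ρ * r))
        (epochEnvelope fun k => if k < -Kb then (1 / 2) * Zf k ^ 2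
          else if Ka < k then (1 / 2) * (ν k * r / w (k - 1)) ^ 2 else (1 / 2) * M k ^ 2)
        S F τ₁ a ∧
      (1 + σ) * a ≤ |S i₀ 1 τ₁| := by
  have hq : 0 < 1 + ε₀ := by linarith
  have hr0 : 0 ≤ r := hr.le
  have hKK : -Kb ≤ Ka := by omega
  -- restrict the flow to `[0, c₀]` and get the all-shell bounds there
  have hflow₀ := pseudoFlowOnShift_mono hflow hc₀ hτ
  have hza' : ∀ i k, Ka < k → |z i k| ≤ (fun _ : ℤ => (0 : ℝ)) k := fun i k hk => by
    rw [hza i k hk, abs_zero]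
  have hZa : ∀ k : ℤ, Ka < k → 4 * (w k * (fun _ : ℤ => (0 : ℝ)) k) ≤ r := fun k _ => by
    simp; exact hr0
  obtain ⟨hwin, hbeh, hahd, hFeq⟩ := exact_flow_bounds h𝕊 h𝕊c h111 hε hαc hCα0 hCα hKb hKa hr0 hw hZf
    hZmin hZmin' hZbf hMZf hcloseB hT1 hZa hcoreTop hthin hν hcloseA hslowA hMν hinside htrap hzc hzb hza'
    hball hc₀ hc₀c hflow₀
  -- the premises of the landing clause
  have hball0 : ∀ i k, -Kb ≤ k → k ≤ Ka → w k * |S i k 0 - z i k| ≤ r := fun i k _ _ => by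
    rw [hflow.init_S]; exact hball i k
  have hderiv : ∀ i k, -Kb ≤ k → k ≤ Ka → ∀ u ∈ Icc 0 c₀,
      HasDerivWithinAt (S i k) (quadTermOn 𝕊 ε₀ α S i k u) (Icc 0 c₀) u :=
    fun i k _ _ u hu => exact_hasDerivWithinAt hflow₀ le_rfl i k hu
  have hScont : ∀ i k, ContinuousOn (S i k) (Icc 0 c₀) := fun i k =>
    (hflow₀.contDiffOn_S i k).continuousOn
  have hweak : ∀ i k, -Kb ≤ k → k ≤ Ka → ∀ u ∈ Icc 0 c₀, |S i k u| ≤ M k :=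
    fun i k h1 h2 u hu => (hwin i k h1 h2 u hu).le
  have hedgeB : ∀ i, ∀ u ∈ Icc 0 c₀, |S i (-Kb - 1) u| ≤ Zf (-Kb - 1) := fun i u hu =>
    (hbeh i (-Kb - 1) (by omega) u hu).1
  have hedgeA : ∀ i, ∀ u ∈ Icc 0 c₀, |S i (Ka + 1) u| ≤ ν (Ka + 1) * r / w Ka := by
    intro i u hu
    have := hahd (Ka + 1) (by omega) u hu i
    rwa [show Ka + 1 - 1 = Ka by ring] at this
  obtain ⟨τ₁, a, z', hτ₁, hτ₁c, ha, haθ, hslack, hz'c, hlandW, hlandTop, hexit⟩ :=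
    hland z S hzc hball0 hderiv (fun i => hScont i _) (fun i => hScont i _) hedgeB hedgeA hweak
  have hτ₁I : τ₁ ∈ Icc 0 c₀ := ⟨hτ₁.le, hτ₁c⟩
  have h1a : ∀ x : ℝ, 0 ≤ x → x / a ≤ (1 + ε₀) ^ θ₀ * x := fun x hx => div_le_rpow_mul hq ha haθ hx
  -- a uniform bound along the flow (for the boundedness of the new reference state)
  obtain ⟨Mu, hMu0, hMu⟩ := pseudoFlowOnShift_uniform_bounds hflow₀ hq
  -- the new reference state
  set z'' : Fin m → ℤ → ℝ := fun i k =>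
    if k < -Kb then S i (1 + k) τ₁ / a else if Ka < k then 0 else z' i k with hz''
  have hz''win : ∀ i k, -Kb ≤ k → k ≤ Ka → z'' i k = z' i k := by
    intro i k h1 h2; simp only [hz'']; rw [if_neg (by omega), if_neg (by omega)]
  have hz''beh : ∀ i k, k < -Kb → z'' i k = S i (1 + k) τ₁ / a := by
    intro i k hk; simp only [hz'']; rw [if_pos hk]
  have hz''ahd : ∀ i k, Ka < k → z'' i k = 0 := by
    intro i k hk; simp only [hz'']; rw [if_neg (by omega), if_pos hk]
  -- membership of `z''` in the fat reference set
  have hz''mem : z'' ∈ {z : Fin m → ℤ → ℝ | Core z ∧ (∀ i j, j < -Kb → |z i j| ≤ Zb j) ∧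
      (∀ i k, Ka < k → z i k = 0) ∧ ∃ C : ℝ, ∀ i k, |z i k| ≤ C} := by
    refine ⟨hcore z' z'' (fun i k h1 h2 => (hz''win i k h1 h2).symm) hz'c, ?_, hz''ahd, ?_⟩
    · intro i j hj
      rw [hz''beh i j hj, abs_div, abs_of_pos ha]
      rcases lt_or_eq_of_le (show 1 + j ≤ -Kb by omega) with hlt | heq
      · -- deep wake: frozen, then shifted
        obtain ⟨-, hdrift⟩ := hbeh i (1 + j) hlt τ₁ hτ₁I
        have hjj : 1 + j - 1 = j := by ring
        rw [hjj] at hdrift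
        have hS₀ : |S₀ i (1 + j)| ≤ Zb (1 + j) + r / w (1 + j) := by
          have h1 : |S₀ i (1 + j) - z i (1 + j)| ≤ r / w (1 + j) := by
            rw [le_div_iff₀ (hw _), mul_comm]; exact hball i (1 + j)
          have h2 := hzb i (1 + j) hlt
          calc |S₀ i (1 + j)| = |(S₀ i (1 + j) - z i (1 + j)) + z i (1 + j)| := by ring_nf
            _ ≤ |S₀ i (1 + j) - z i (1 + j)| + |z i (1 + j)| := abs_add_le _ _
            _ ≤ Zb (1 + j) + r / w (1 + j) := by linarith
        have hSτ : |S i (1 + j) τ₁| ≤ Zb (1 + j) + r / w (1 + j) +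
            c * (8 * Cα * (1 + ε₀) ^ ((5 : ℝ) * ((1 + j : ℤ) : ℝ) / 2) *
              max (Zf j) (max (Zf (1 + j)) (Zf (1 + j + 1))) *
              max (Zf j) (max (Zf (1 + j)) (Zf (1 + j + 1)))) := by
          have : |S i (1 + j) τ₁| ≤ |S i (1 + j) τ₁ - S₀ i (1 + j)| + |S₀ i (1 + j)| := by
            have := abs_add_le (S i (1 + j) τ₁ - S₀ i (1 + j)) (S₀ i (1 + j))
            rwa [sub_add_cancel] at this
          linarith
        have hnn : 0 ≤ |S i (1 + j) τ₁| := abs_nonneg _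
        have hsh := hshiftB (1 + j) hlt
        simp only [hjj] at hsh
        calc |S i (1 + j) τ₁| / a ≤ (1 + ε₀) ^ θ₀ * |S i (1 + j) τ₁| := h1a _ hnn
          _ ≤ (1 + ε₀) ^ θ₀ * (Zb (1 + j) + r / w (1 + j) +
              c * (8 * Cα * (1 + ε₀) ^ ((5 : ℝ) * ((1 + j : ℤ) : ℝ) / 2) *
                max (Zf j) (max (Zf (1 + j)) (Zf (1 + j + 1))) *
                max (Zf j) (max (Zf (1 + j)) (Zf (1 + j + 1))))) :=
              mul_le_mul_of_nonneg_left hSτ (Real.rpow_nonneg hq.le θ₀)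
          _ ≤ Zb j := hsh
      · -- the old bottom window shell exits under the envelope
        have h1j : 1 + j = -Kb := heq
        rw [h1j, div_le_iff₀ ha]
        have := hexit i
        rw [show -Kb - 1 = j by omega] at this
        linarith
    · -- boundedness
      obtain ⟨Cw, hCw⟩ : ∃ Cw : ℝ, ∀ i k, -Kb ≤ k → k ≤ Ka → |z' i k| ≤ Cw := by
        refine ⟨(Finset.Icc (-Kb) Ka).sup' ⟨Ka, Finset.mem_Icc.mpr ⟨hKK, le_rfl⟩⟩ (fun k => M k), ?_⟩
        intro i k h1 h2
        have hlt : |z' i k| < M k :=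
          hinside z' z' hz'c (fun i k _ _ => by simp [hr0]) i k h1 h2
        exact hlt.le.trans (Finset.le_sup' (fun k => M k) (Finset.mem_Icc.mpr ⟨h1, h2⟩))
      refine ⟨max Cw (Mu / a), fun i k => ?_⟩
      by_cases hk1 : k < -Kb
      · rw [hz''beh i k hk1, abs_div, abs_of_pos ha]
        exact le_trans (div_le_div_of_nonneg_right (hMu τ₁ hτ₁I i (1 + k)).1 ha.le) (le_max_right _ _)
      · by_cases hk2 : Ka < k
        · rw [hz''ahd i k hk2, abs_zero]
          exact le_trans (div_nonneg hMu0 ha.le) (le_max_right _ _)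
        · push Not at hk1 hk2
          rw [hz''win i k hk1 hk2]
          exact (hCw i k hk1 hk2).trans (le_max_left _ _)
  refine ⟨τ₁, a, ⟨hτ₁, hτ₁c, ha, haθ, ?_, ⟨z'', hz''mem, fun i k => ?_⟩, ?_⟩, hslack⟩
  · -- amplitude: a ≤ (1+σ) a ≤ |S_{i₀,1}(τ₁)|
    nlinarith
  · -- the ball around `z''`
    by_cases hk1 : k < -Kb
    · rw [hz''beh i k hk1, sub_self, abs_zero, mul_zero]; positivity
    · by_cases hk2 : Ka < k
      · rw [hz''ahd i k hk2, sub_zero, abs_div, abs_of_pos ha]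
        have hS := hahd (1 + k) (by omega) τ₁ hτ₁I i
        rw [show 1 + k - 1 = k by ring] at hS
        have hνk := hshiftA k hk2
        have hwk := hw k
        calc w k * (|S i (1 + k) τ₁| / a) ≤ w k * ((1 + ε₀) ^ θ₀ * (ν (1 + k) * r / w k)) :=
              mul_le_mul_of_nonneg_left ((h1a _ (abs_nonneg _)).trans
                (mul_le_mul_of_nonneg_left hS (Real.rpow_nonneg hq.le θ₀))) hwk.le
          _ = (ν (k + 1) * (1 + ε₀) ^ θ₀) * r := by rw [add_comm 1 k]; field_simp
          _ ≤ ρ * r := mul_le_mul_of_nonneg_right hνk hr0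
      · push Not at hk1 hk2
        rw [hz''win i k hk1 hk2]
        rcases lt_or_eq_of_le hk2 with hlt | heq
        · exact hlandW i k hk1 (by omega)
        · show w k * |S i (1 + k) τ₁ / a - z' i k| ≤ ρ * r
          rw [heq]
          have hv : |S i (Ka + 1) τ₁| ≤ ν (Ka + 1) * r / w Ka := hedgeA i τ₁ hτ₁I
          have := hlandTop i (S i (Ka + 1) τ₁) hv
          rwa [show (1 : ℤ) + Ka = Ka + 1 by ring]
  · -- the epoch envelope on `[0, τ₁]`
    intro u hu i k
    have huc : u ∈ Icc 0 c₀ := ⟨hu.1, hu.2.trans hτ₁c⟩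
    show F i k u ≤ (if k < -Kb then (1 / 2) * Zf k ^ 2
      else if Ka < k then (1 / 2) * (ν k * r / w (k - 1)) ^ 2 else (1 / 2) * M k ^ 2)
    rw [hFeq i k u huc]
    by_cases hk1 : k < -Kb
    · rw [if_pos hk1]
      have h1 := (hbeh i k hk1 u huc).1
      have : S i k u ^ 2 ≤ Zf k ^ 2 := by
        rw [← sq_abs (S i k u)]; exact pow_le_pow_left₀ (abs_nonneg _) h1 2
      linarith
    · rw [if_neg hk1]
      by_cases hk2 : Ka < k
      · rw [if_pos hk2]
        have h1 := hahd k hk2.le u huc i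
        have : S i k u ^ 2 ≤ (ν k * r / w (k - 1)) ^ 2 := by
          rw [← sq_abs (S i k u)]; exact pow_le_pow_left₀ (abs_nonneg _) h1 2
        linarith
      · rw [if_neg hk2]
        push Not at hk1 hk2
        have h1 := (hwin i k hk1 hk2 u huc).le
        have : S i k u ^ 2 ≤ M k ^ 2 := by
          rw [← sq_abs (S i k u)]; exact pow_le_pow_left₀ (abs_nonneg _) h1 2
        linarith

end CertificateGlueOn

end Summit.NavierStokesRegularity.NavierStokesRegularity.Theorems

end
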